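import Summits.CriticalPhenomena.PercolationContinuityZ3.Theorems.PercNearOneGluingNearOneGluingShorteningReduction
import HarnessLib

/-!
# Crux `PercNearOneGluing.NoHeavyLowerTail` (stmt-CriticalPhenomena-4575), line `additive-shortening`:
# the additive shortening step — its exact UNcontracted residual, and its closed faces

Lead c7, 2026-08-17; lands with `--supports stmt-CriticalPhenomena-4575`.

Write `μ = prodBernoulli w` (the pair `s(v,x)` has weight `0` in the instances of interest),
`μ₁ = prodBernoulli (w[s(v,x) ↦ 1])` (the pair glued), `V = {v, x}`, `{V ↔ z} = {v ↔ z} ∪ {x ↔ z}`,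
`E = {V ↔ A}`, `Fb = {V ↔ b}`, `N = {a₀ ↮ v} ∩ {a₀ ↮ x}`,
`K = {a₀ ↔ b} ∪ ({a₀ ↔ v} ∩ {x ↔ b}) ∪ ({a₀ ↔ x} ∩ {v ↔ b})`.
The ADDITIVE shortening step (registered stub `stub_additiveShorteningStep`) concludes
`μ₁(v ↔ A) − (1 − μ₁(a₀ ↔ b)) ≤ μ₁(v ↔ b)`.

* `additiveStep_of_multiplicativeStep` — instance-wise, Kozma–Nitzan's multiplicative conclusion
  `μ₁(v ↔ A)·μ₁(a₀ ↔ b) ≤ μ₁(v ↔ b)` implies the additive one (`yz ≥ y + z − 1` on `[0,1]`).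
* CLOSED FACES (from the sibling crux's `shorteningStep_of_le_partner/_le_source`, KN Lemma 3 for the
  mixed-monotone event `N`, BHK 2006 Thm 1.5): the additive step holds outright, for every relay set `A` and any
  designated `a₀`, as soon as `μ(a₀ ↔ b) ≤ μ(x ↔ b)` (`additiveStep_of_le_partner`; in particular when `x ∈ A`
  and `a₀` is the minimiser, `additiveStep_of_partner_mem`, or `b = x`) or `μ(a₀ ↔ b) ≤ μ(v ↔ b)`
  (`additiveStep_of_le_source`; in particular `b = v`).
* EXACT RESIDUAL (`additiveStep_iff_exchangeAdd`, pure transport + event algebra, no correlation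
  inequality): for `v ≠ x` and `a₀ ∈ A`,
  `[additive step] ↔ μ({a₀ ↔ b} ∩ N) ≤ μ(Fb ∩ N) + μ(Eᶜ)`,
  i.e. in the contracted graph with source `o = V`: `P(a₀ ↔ b, o ↮ a₀) ≤ P(o ↔ b, o ↮ a₀) + P(o ↮ A)`,
  equivalently `P(a₀ ↔ b) ≤ P(o ↔ b) + P(o ↮ A)` — additive Conjecture 1 at the glued source with the
  designated (old-minimiser) relay.  The multiplicative step's sufficient condition
  (`shorteningStep_of_setSourceExchange`) is the same inequality without the `μ(Eᶜ)` term and with the left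
  side restricted to `E`.
What remains OPEN of the registered stub is therefore exactly: `μ(v ↔ b) < μ(a₀ ↔ b)`, `μ(x ↔ b) < μ(a₀ ↔ b)`
(so `v, x, b ∉ A`), `|A| ≥ 3` (the case `|A| ≤ 2` is the sibling crux's `stub_shorteningStep_var2415`), with the
residual inequality above.  No new definitions, no named facts.
-/

namespace Summit.CriticalPhenomena.PercolationContinuityZ3.Theorems

open MeasureTheory Set Literature.Probability.LatticeModels Literature.Probability.Percolation
open scoped Classical BigOperators

/-- `y z ≥ y + z − 1` for `y ≤ 1`, `0 ≤ z`... precisely: from `y ≤ 1`, `z ≤ 1` and `y z ≤ x` conclude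
`y − (1 − z) ≤ x`. [folklore] -/
theorem addStepRes_sub_le_of_mul_le {x y z : ℝ} (hy : y ≤ 1) (hz : z ≤ 1) (h : y * z ≤ x) :
    y - (1 - z) ≤ x := by
  nlinarith [mul_nonneg (sub_nonneg.2 hy) (sub_nonneg.2 hz)]

/-- **Multiplicative ⇒ additive, instance-wise.**  If `μ₁(v ↔ A)·μ₁(a₀ ↔ b) ≤ μ₁(v ↔ b)` (the conclusion of
Kozma–Nitzan's Conjecture 6) then `μ₁(v ↔ A) − (1 − μ₁(a₀ ↔ b)) ≤ μ₁(v ↔ b)` (the conclusion of the additive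
shortening step), for any weight function (here `w'`, typically `w[s(v,x) ↦ 1]`). -/
theorem additiveStep_of_multiplicativeStep {n : ℕ} (w' : Sym2 (Fin n) → unitInterval)
    (A : Finset (Fin n)) (b v a₀ : Fin n)
    (h : (prodBernoulli w').real (⋃ a ∈ A, openConn v a) * (prodBernoulli w').real (openConn a₀ b) ≤
      (prodBernoulli w').real (openConn v b)) :
    (prodBernoulli w').real (⋃ a ∈ A, openConn v a) - (1 - (prodBernoulli w').real (openConn a₀ b)) ≤
      (prodBernoulli w').real (openConn v b) :=
  addStepRes_sub_le_of_mul_le measureReal_le_one measureReal_le_one h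

/-- **Face: the glued partner is at least as reliable as the designated relay.**  If `μ(a₀ ↔ b) ≤ μ(x ↔ b)`
then the additive step holds at `(v, x)` for every relay set `A` (from `shorteningStep_of_le_partner`). -/
theorem additiveStep_of_le_partner : ∀ (n : ℕ) (w : Sym2 (Fin n) → unitInterval) (A : Finset (Fin n)) (b v x a₀ : Fin n), v ≠ x → (prodBernoulli w).real (openConn a₀ b) ≤ (prodBernoulli w).real (openConn x b) → (prodBernoulli (Function.update w s(v, x) 1)).real (⋃ a ∈ A, openConn v a) - (1 - (prodBernoulli (Function.update w s(v, x) 1)).real (openConn a₀ b)) ≤ (prodBernoulli (Function.update w s(v, x) 1)).real (openConn v b) :=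
  fun n w A b v x a₀ hvx hle =>
    additiveStep_of_multiplicativeStep _ A b v a₀ (shorteningStep_of_le_partner n w A b v x a₀ hvx hle)

/-- **Face: the source is at least as reliable as the designated relay.**  If `μ(a₀ ↔ b) ≤ μ(v ↔ b)` then the
additive step holds at `(v, x)` for every relay set `A` (from `shorteningStep_of_le_source`). -/
theorem additiveStep_of_le_source : ∀ (n : ℕ) (w : Sym2 (Fin n) → unitInterval) (A : Finset (Fin n)) (b v x a₀ : Fin n), v ≠ x → (prodBernoulli w).real (openConn a₀ b) ≤ (prodBernoulli w).real (openConn v b) → (prodBernoulli (Function.update w s(v, x) 1)).real (⋃ a ∈ A, openConn v a) - (1 - (prodBernoulli (Function.update w s(v, x) 1)).real (openConn a₀ b)) ≤ (prodBernoulli (Function.update w s(v, x) 1)).real (openConn v b) :=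
  fun n w A b v x a₀ hvx hle =>
    additiveStep_of_multiplicativeStep _ A b v a₀ (shorteningStep_of_le_source n w A b v x a₀ hvx hle)

/-- **Face `x ∈ A`** of the additive step: if the glued partner is itself a relay and `a₀` minimises
`μ(· ↔ b)` on `A`, the step holds. -/
theorem additiveStep_of_partner_mem : ∀ (n : ℕ) (w : Sym2 (Fin n) → unitInterval) (A : Finset (Fin n)) (b v x a₀ : Fin n), v ≠ x → x ∈ A → (∀ a ∈ A, (prodBernoulli w).real (openConn a₀ b) ≤ (prodBernoulli w).real (openConn a b)) → (prodBernoulli (Function.update w s(v, x) 1)).real (⋃ a ∈ A, openConn v a) - (1 - (prodBernoulli (Function.update w s(v, x) 1)).real (openConn a₀ b)) ≤ (prodBernoulli (Function.update w s(v, x) 1)).real (openConn v b) :=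
  fun n w A b v x a₀ hvx hx hmin => additiveStep_of_le_partner n w A b v x a₀ hvx (hmin x hx)

/-- **Face `b = x`** (the target is the glued partner): `μ(a₀ ↔ b) ≤ 1 = μ(b ↔ b)`. -/
theorem additiveStep_of_target_eq_partner : ∀ (n : ℕ) (w : Sym2 (Fin n) → unitInterval) (A : Finset (Fin n)) (v x a₀ : Fin n), v ≠ x → (prodBernoulli (Function.update w s(v, x) 1)).real (⋃ a ∈ A, openConn v a) - (1 - (prodBernoulli (Function.update w s(v, x) 1)).real (openConn a₀ x)) ≤ (prodBernoulli (Function.update w s(v, x) 1)).real (openConn v x) := by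
  intro n w A v x a₀ hvx
  refine additiveStep_of_le_partner n w A x v x a₀ hvx ?_
  have h1 : (prodBernoulli w).real (openConn x x) = 1 := by
    have : (openConn x x : Set (BondConfig (Fin n))) = Set.univ :=
      Set.eq_univ_of_forall fun ω => (SimpleGraph.Reachable.refl x : (openGraph ω).Reachable x x)
    rw [this, probReal_univ]
  rw [h1]
  exact measureReal_le_one

/-- **Face `b = v`** (the target is the source): `μ(a₀ ↔ b) ≤ 1 = μ(b ↔ b)`. -/
theorem additiveStep_of_target_eq_source : ∀ (n : ℕ) (w : Sym2 (Fin n) → unitInterval) (A : Finset (Fin n)) (v x a₀ : Fin n), v ≠ x → (prodBernoulli (Function.update w s(v, x) 1)).real (⋃ a ∈ A, openConn v a) - (1 - (prodBernoulli (Function.update w s(v, x) 1)).real (openConn a₀ v)) ≤ (prodBernoulli (Function.update w s(v, x) 1)).real (openConn v v) := by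
  intro n w A v x a₀ hvx
  refine additiveStep_of_le_source n w A v v x a₀ hvx ?_
  have h1 : (prodBernoulli w).real (openConn v v) = 1 := by
    have : (openConn v v : Set (BondConfig (Fin n))) = Set.univ :=
      Set.eq_univ_of_forall fun ω => (SimpleGraph.Reachable.refl v : (openGraph ω).Reachable v v)
    rw [this, probReal_univ]
  rw [h1]
  exact measureReal_le_one

/-! ## The exact uncontracted residual -/

section Residual

variable {n : ℕ}

/-- Reachability after inserting the pair `s(v,x)`: `y ↔ z` in `insert s(v,x) ω` iff, in `ω`, `y ↔ z` or
`(y ↔ v ∧ x ↔ z)` or `(y ↔ x ∧ v ↔ z)` (`v ≠ x`). [folklore] -/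
theorem addStepRes_reachable_insert_iff (ω : BondConfig (Fin n)) {v x : Fin n} (hvx : v ≠ x) (y z : Fin n) :
    (openGraph (insert s(v, x) ω)).Reachable y z ↔
      ((openGraph ω).Reachable y z ∨ ((openGraph ω).Reachable y v ∧ (openGraph ω).Reachable x z) ∨
        ((openGraph ω).Reachable y x ∧ (openGraph ω).Reachable v z)) := by
  constructor
  · exact pivDom_reachable_insert ω v x y z
  · rintro (h | ⟨h1, h2⟩ | ⟨h1, h2⟩)
    · exact h.mono (openGraph_mono (Set.subset_insert _ _))
    · exact (h1.mono (openGraph_mono (Set.subset_insert _ _))).trans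
        (pivDom_reachable_insert_of ω hvx h2)
    · have h3 : (openGraph (insert s(x, v) ω)).Reachable x z := pivDom_reachable_insert_of ω hvx.symm h2
      rw [Sym2.eq_swap] at h3
      exact (h1.mono (openGraph_mono (Set.subset_insert _ _))).trans h3

/-- Transport of the glued measure: `μ₁(F) = μ(insert s(v,x) ⁻¹' F)`. [folklore] -/
theorem addStepRes_real_glued_eq (w : Sym2 (Fin n) → unitInterval) (v x : Fin n)
    (F : Set (BondConfig (Fin n))) :
    (prodBernoulli (Function.update w s(v, x) 1)).real F =
      (prodBernoulli w).real ((fun ω : BondConfig (Fin n) => insert s(v, x) ω) ⁻¹' F) := by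
  have hmi : Measurable fun ω : BondConfig (Fin n) => insert s(v, x) ω := by
    refine measurable_set_iff.2 fun i => ?_
    simp only [Set.mem_insert_iff]
    exact measurable_const.or (measurable_set_mem i)
  rw [← goodStepEI_prodBernoulli_map_insert w s(v, x), map_measureReal_apply hmi MeasurableSet.of_discrete]

/-- The glued source reaches the relay set iff the pair `V = {v,x}` does: preimage of `{v ↔ A}`. [folklore] -/
theorem addStepRes_preimage_reachA (A : Finset (Fin n)) {v x : Fin n} (hvx : v ≠ x) :
    (fun ω : BondConfig (Fin n) => insert s(v, x) ω) ⁻¹' (⋃ a ∈ A, openConn v a) =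
      {ω | ∃ a ∈ A, (openGraph ω).Reachable v a ∨ (openGraph ω).Reachable x a} := by
  ext ω
  simp only [Set.mem_preimage, Set.mem_iUnion, exists_prop, Set.mem_setOf_eq]
  constructor
  · rintro ⟨a, ha, h⟩
    refine ⟨a, ha, ?_⟩
    rcases (addStepRes_reachable_insert_iff ω hvx v a).1 h with h1 | ⟨-, h1⟩ | ⟨-, h1⟩
    exacts [Or.inl h1, Or.inr h1, Or.inl h1]
  · rintro ⟨a, ha, h⟩
    refine ⟨a, ha, (addStepRes_reachable_insert_iff ω hvx v a).2 ?_⟩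
    rcases h with h | h
    · exact Or.inl h
    · exact Or.inr (Or.inl ⟨SimpleGraph.Reachable.refl v, h⟩)

/-- Preimage of `{v ↔ b}`: `{v ↔ b} ∪ {x ↔ b}`. [folklore] -/
theorem addStepRes_preimage_reachb {v x : Fin n} (hvx : v ≠ x) (b : Fin n) :
    (fun ω : BondConfig (Fin n) => insert s(v, x) ω) ⁻¹' (openConn v b) = openConn v b ∪ openConn x b := by
  ext ω
  change (openGraph (insert s(v, x) ω)).Reachable v b ↔
    (openGraph ω).Reachable v b ∨ (openGraph ω).Reachable x b
  rw [addStepRes_reachable_insert_iff ω hvx v b]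
  constructor
  · rintro (h | ⟨-, h⟩ | ⟨-, h⟩)
    exacts [Or.inl h, Or.inr h, Or.inl h]
  · rintro (h | h)
    · exact Or.inl h
    · exact Or.inr (Or.inl ⟨SimpleGraph.Reachable.refl v, h⟩)

/-- Preimage of `{a₀ ↔ b}`: `K = {a₀ ↔ b} ∪ ({a₀ ↔ v} ∩ {x ↔ b}) ∪ ({a₀ ↔ x} ∩ {v ↔ b})`. [folklore] -/
theorem addStepRes_preimage_relay {v x : Fin n} (hvx : v ≠ x) (a₀ b : Fin n) :
    (fun ω : BondConfig (Fin n) => insert s(v, x) ω) ⁻¹' (openConn a₀ b) =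
      openConn a₀ b ∪ ((openConn a₀ v ∩ openConn x b) ∪ (openConn a₀ x ∩ openConn v b)) := by
  ext ω
  change (openGraph (insert s(v, x) ω)).Reachable a₀ b ↔
    (openGraph ω).Reachable a₀ b ∨ (((openGraph ω).Reachable a₀ v ∧ (openGraph ω).Reachable x b) ∨
      ((openGraph ω).Reachable a₀ x ∧ (openGraph ω).Reachable v b))
  rw [addStepRes_reachable_insert_iff ω hvx a₀ b]

/-- **The exact uncontracted residual of the additive shortening step.**  For `v ≠ x` and `a₀ ∈ A`
(any weight function `w`; the glued pair is `s(v,x)`):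
`μ₁(v ↔ A) − (1 − μ₁(a₀ ↔ b)) ≤ μ₁(v ↔ b)`  ↔  `μ({a₀ ↔ b} ∩ N) ≤ μ(({v ↔ b} ∪ {x ↔ b}) ∩ N) + μ({V ↮ A})`
with `N = {a₀ ↮ v} ∩ {a₀ ↮ x}`.  Transport along `ω ↦ insert s(v,x) ω` (three exact preimages) and the
event identities `K ∩ N = {a₀ ↔ b} ∩ N`, `Nᶜ = (K ∩ Nᶜ) ⊔ (E ∩ Fbᶜ ∩ Nᶜ)`, `Fb ∩ Nᶜ ⊆ E`, `Eᶜ ⊆ N`, which give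
`μ(E) + μ(K) − 1 − μ(Fb) = μ({a₀ ↔ b} ∩ N) − μ(Fb ∩ N) − μ(Eᶜ)`. -/
theorem additiveStep_iff_exchangeAdd : ∀ (n : ℕ) (w : Sym2 (Fin n) → unitInterval) (A : Finset (Fin n)) (b v x a₀ : Fin n), v ≠ x → a₀ ∈ A → (((prodBernoulli (Function.update w s(v, x) 1)).real (⋃ a ∈ A, openConn v a) - (1 - (prodBernoulli (Function.update w s(v, x) 1)).real (openConn a₀ b)) ≤ (prodBernoulli (Function.update w s(v, x) 1)).real (openConn v b)) ↔ (prodBernoulli w).real (openConn a₀ b ∩ {ω | ¬ (openGraph ω).Reachable a₀ v ∧ ¬ (openGraph ω).Reachable a₀ x}) ≤ (prodBernoulli w).real ((openConn v b ∪ openConn x b) ∩ {ω | ¬ (openGraph ω).Reachable a₀ v ∧ ¬ (openGraph ω).Reachable a₀ x}) + (prodBernoulli w).real {ω | ∃ a ∈ A, (openGraph ω).Reachable v a ∨ (openGraph ω).Reachable x a}ᶜ) := by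
  intro n w A b v x a₀ hvx ha₀
  have hmeas : ∀ S : Set (BondConfig (Fin n)), MeasurableSet S := fun S => MeasurableSet.of_discrete
  -- the events
  set Fb : Set (BondConfig (Fin n)) := openConn v b ∪ openConn x b with hFb
  set E : Set (BondConfig (Fin n)) :=
    {ω | ∃ a ∈ A, (openGraph ω).Reachable v a ∨ (openGraph ω).Reachable x a} with hE
  set K : Set (BondConfig (Fin n)) :=
    openConn a₀ b ∪ ((openConn a₀ v ∩ openConn x b) ∪ (openConn a₀ x ∩ openConn v b)) with hK
  set N : Set (BondConfig (Fin n)) :=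
    {ω | ¬ (openGraph ω).Reachable a₀ v ∧ ¬ (openGraph ω).Reachable a₀ x} with hN
  -- (1) the three transports are exact
  have hY : (prodBernoulli (Function.update w s(v, x) 1)).real (⋃ a ∈ A, openConn v a) =
      (prodBernoulli w).real E := by
    rw [addStepRes_real_glued_eq, addStepRes_preimage_reachA A hvx]
  have hX : (prodBernoulli (Function.update w s(v, x) 1)).real (openConn v b) =
      (prodBernoulli w).real Fb := by
    rw [addStepRes_real_glued_eq, addStepRes_preimage_reachb hvx]
  have hZ : (prodBernoulli (Function.update w s(v, x) 1)).real (openConn a₀ b) =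
      (prodBernoulli w).real K := by
    rw [addStepRes_real_glued_eq, addStepRes_preimage_relay hvx]
  -- (2) event algebra
  have hKN : K ∩ N = openConn a₀ b ∩ N := by
    ext ω
    constructor
    · rintro ⟨hk, hv', hx'⟩
      rcases hk with h | ⟨h, -⟩ | ⟨h, -⟩
      exacts [⟨h, hv', hx'⟩, absurd h hv', absurd h hx']
    · rintro ⟨h, hω⟩
      exact ⟨Or.inl h, hω⟩
  have hEc : Eᶜ ⊆ N := by
    intro ω hω
    have hω' : ¬ ∃ a ∈ A, (openGraph ω).Reachable v a ∨ (openGraph ω).Reachable x a := hω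
    refine ⟨fun h => hω' ⟨a₀, ha₀, Or.inl h.symm⟩, fun h => hω' ⟨a₀, ha₀, Or.inr h.symm⟩⟩
  have hFbT : Fb ∩ Nᶜ ⊆ E := by
    rintro ω ⟨-, hT⟩
    have hT' : (openGraph ω).Reachable a₀ v ∨ (openGraph ω).Reachable a₀ x := by
      by_contra h
      push Not at h
      exact hT h
    rcases hT' with h | h
    exacts [⟨a₀, ha₀, Or.inl h.symm⟩, ⟨a₀, ha₀, Or.inr h.symm⟩]
  -- `Nᶜ ⊆ K ∪ (E ∩ Fbᶜ)` and `K ∩ (E ∩ Fbᶜ) ∩ Nᶜ = ∅`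
  have hTsplit : Nᶜ = (K ∩ Nᶜ) ∪ ((E \ Fb) ∩ Nᶜ) := by
    ext ω
    simp only [Set.mem_compl_iff, Set.mem_union, Set.mem_inter_iff, Set.mem_sdiff]
    constructor
    · intro hT
      by_cases hk : ω ∈ K
      · exact Or.inl ⟨hk, hT⟩
      · right
        have hT' : (openGraph ω).Reachable a₀ v ∨ (openGraph ω).Reachable a₀ x := by
          by_contra h
          push Not at h
          exact hT h
        have hab : ¬ (openGraph ω).Reachable a₀ b := fun h => hk (Or.inl h)
        refine ⟨⟨?_, ?_⟩, hT⟩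
        · rcases hT' with h | h
          exacts [⟨a₀, ha₀, Or.inl h.symm⟩, ⟨a₀, ha₀, Or.inr h.symm⟩]
        · rintro (hvb | hxb)
          · rcases hT' with h | h
            · exact hab (h.trans hvb)
            · exact hk (Or.inr (Or.inr ⟨h, hvb⟩))
          · rcases hT' with h | h
            · exact hk (Or.inr (Or.inl ⟨h, hxb⟩))
            · exact hab (h.trans hxb)
    · rintro (⟨-, hT⟩ | ⟨-, hT⟩) <;> exact hT
  have hTdisj : Disjoint (K ∩ Nᶜ) ((E \ Fb) ∩ Nᶜ) := by
    rw [Set.disjoint_left]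
    rintro ω ⟨hk, hT⟩ ⟨⟨-, hnFb⟩, -⟩
    have hT' : (openGraph ω).Reachable a₀ v ∨ (openGraph ω).Reachable a₀ x := by
      by_contra h
      push Not at h
      exact hT h
    rcases hk with hab | ⟨_, hxb⟩ | ⟨_, hvb⟩
    · rcases hT' with h | h
      · exact hnFb (Or.inl (h.symm.trans hab))
      · exact hnFb (Or.inr (h.symm.trans hab))
    · exact hnFb (Or.inr hxb)
    · exact hnFb (Or.inl hvb)
  -- (3) measure bookkeeping
  have hT1 : (prodBernoulli w).real Nᶜ =
      (prodBernoulli w).real (K ∩ Nᶜ) + (prodBernoulli w).real ((E \ Fb) ∩ Nᶜ) := by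
    conv_lhs => rw [hTsplit]
    exact measureReal_union hTdisj (hmeas _)
  have hE1 : (prodBernoulli w).real (E ∩ Nᶜ) =
      (prodBernoulli w).real (Fb ∩ Nᶜ) + (prodBernoulli w).real ((E \ Fb) ∩ Nᶜ) := by
    have h1 := measureReal_inter_add_sdiff (μ := prodBernoulli w) (s := E ∩ Nᶜ) (hmeas Fb)
    have h2 : E ∩ Nᶜ ∩ Fb = Fb ∩ Nᶜ := by
      ext ω
      constructor
      · rintro ⟨⟨-, hT⟩, hf⟩
        exact ⟨hf, hT⟩
      · rintro ⟨hf, hT⟩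
        exact ⟨⟨hFbT ⟨hf, hT⟩, hT⟩, hf⟩
    have h3 : (E ∩ Nᶜ) \ Fb = (E \ Fb) ∩ Nᶜ := by
      ext ω
      simp only [Set.mem_sdiff, Set.mem_inter_iff, Set.mem_compl_iff]
      tauto
    rw [h2, h3] at h1
    linarith
  have hEN : (prodBernoulli w).real (E ∩ N) + (prodBernoulli w).real Eᶜ = (prodBernoulli w).real N := by
    have h1 := measureReal_inter_add_sdiff (μ := prodBernoulli w) (s := N) (hmeas E)
    have h2 : N ∩ E = E ∩ N := Set.inter_comm _ _
    have h3 : N \ E = Eᶜ := by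
      ext ω
      simp only [Set.mem_sdiff, Set.mem_compl_iff]
      exact ⟨fun h => h.2, fun h => ⟨hEc h, h⟩⟩
    rw [h2, h3] at h1
    linarith
  have hEsplit : (prodBernoulli w).real (E ∩ N) + (prodBernoulli w).real (E ∩ Nᶜ) =
      (prodBernoulli w).real E := by
    have h := measureReal_inter_add_sdiff (μ := prodBernoulli w) (s := E) (hmeas N)
    rwa [Set.sdiff_eq] at h
  have hKsplit : (prodBernoulli w).real (openConn a₀ b ∩ N) + (prodBernoulli w).real (K ∩ Nᶜ) =
      (prodBernoulli w).real K := by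
    have h := measureReal_inter_add_sdiff (μ := prodBernoulli w) (s := K) (hmeas N)
    rwa [Set.sdiff_eq, hKN] at h
  have hFsplit : (prodBernoulli w).real (Fb ∩ N) + (prodBernoulli w).real (Fb ∩ Nᶜ) =
      (prodBernoulli w).real Fb := by
    have h := measureReal_inter_add_sdiff (μ := prodBernoulli w) (s := Fb) (hmeas N)
    rwa [Set.sdiff_eq] at h
  have hNsplit : (prodBernoulli w).real N + (prodBernoulli w).real Nᶜ = 1 := by
    rw [measureReal_add_measureReal_compl (hmeas N), probReal_univ]
  rw [hY, hX, hZ]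
  constructor
  · intro h
    linarith
  · intro h
    linarith


end Residual

/-- **The additive shortening step from the additive set-source exchange inequality** (the `←` direction
of `additiveStep_iff_exchangeAdd`, stated for use): if
`μ({a₀ ↔ b} ∩ N) ≤ μ(({v ↔ b} ∪ {x ↔ b}) ∩ N) + μ({V ↮ A})`, `N = {a₀ ↮ v} ∩ {a₀ ↮ x}`, then
`μ₁(v ↔ A) − (1 − μ₁(a₀ ↔ b)) ≤ μ₁(v ↔ b)`. -/
theorem additiveStep_of_exchangeAdd : ∀ (n : ℕ) (w : Sym2 (Fin n) → unitInterval) (A : Finset (Fin n)) (b v x a₀ : Fin n), v ≠ x → a₀ ∈ A → (prodBernoulli w).real (openConn a₀ b ∩ {ω | ¬ (openGraph ω).Reachable a₀ v ∧ ¬ (openGraph ω).Reachable a₀ x}) ≤ (prodBernoulli w).real ((openConn v b ∪ openConn x b) ∩ {ω | ¬ (openGraph ω).Reachable a₀ v ∧ ¬ (openGraph ω).Reachable a₀ x}) + (prodBernoulli w).real {ω | ∃ a ∈ A, (openGraph ω).Reachable v a ∨ (openGraph ω).Reachable x a}ᶜ → (prodBernoulli (Function.update w s(v, x) 1)).real (⋃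 a ∈ A, openConn v a) - (1 - (prodBernoulli (Function.update w s(v, x) 1)).real (openConn a₀ b)) ≤ (prodBernoulli (Function.update w s(v, x) 1)).real (openConn v b) :=
  fun n w A b v x a₀ hvx ha₀ h => (additiveStep_iff_exchangeAdd n w A b v x a₀ hvx ha₀).2 h

end Summit.CriticalPhenomena.PercolationContinuityZ3.Theorems
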